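import Summits.Ventures.PercRepro.Night2FatZOneC

/-!
# night-2: exactly one basis point on the spine (D) — `N = 7` and `N ≥ 8` with a unique off-spine point of a plane

`basis_pair_fair_fat_of_two_planes_one_seven` (`1.149` off the basis lines, `1.016` on one) and
`basis_pair_fair_fat_of_two_planes_one_eight_le` (the free-point theorem or the line-point numerics with `s ≤ 1`).
Paper `proofs/NIGHT-2-g34.md` §6 (b).
-/

namespace PercRepro.Shadow

open PercRepro.ThmH PercRepro.PerFlat

variable {α : Type*} [DecidableEq α] {M : Matroid α} [M.Finite] {G : Finset α}

/-- **One basis point on the spine, `N = 7`, a unique point `y₂` of `W ∖ {x}` in `π₂` off the spine**: the targets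
through `x, y₂` — all unloaded from level `2` when `y₂` is on no basis line (`1.149`), all but `C(s, j − 2)`, `s ≤ 1`,
when it is (`1.016`) — with the levels `5, 6, 7` (spine of at most four points). -/
theorem basis_pair_fair_fat_of_two_planes_one_seven (hG : G ∈ flatsQ M (5 + 1)) (hd : (gr M \ G).card = 2)
    (hk : kColoops M G = 1) (hs : ∀ e ∈ gr M, ∀ f ∈ gr M, e ≠ f → rkN M {e, f} = 2)
    (hl : ∀ e ∈ gr M, M.Indep {e}) (hfat : (fatClosures M 5 G 2).card ≤ 1)
    {B₀ : Finset α} (hB₀ : B₀ ∈ thinMembers M 5 G) {w₀ x : α} (hD : G \ clF M B₀ = {w₀, x}) (hne : w₀ ≠ x) {R₁ : Finset α}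
    (hR₁V : R₁ ⊆ (G \ coloops M G) \ {w₀, x}) (hR₁2 : rkN M R₁ = 2) (hR₁3 : 3 ≤ R₁.card) {c₂ c₃ : α}
    (hc₂V : c₂ ∈ (G \ coloops M G) \ {w₀, x}) (hc₃V : c₃ ∈ (G \ coloops M G) \ {w₀, x})
    (hc₂ : c₂ ∉ clF M R₁) (hc₃ : c₃ ∉ clF M (insert c₂ R₁))
    (hcover : ∀ e ∈ (G \ coloops M G) \ {w₀, x}, e ∈ clF M (insert c₂ R₁) ∨ e ∈ clF M (insert c₃ R₁))
    (hnd₂ : 3 ≤ rkN M (((G \ coloops M G) \ {w₀, x}).filter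
      (fun e => e ∈ clF M (insert c₂ R₁) ∧ e ∉ clF M R₁)))
    (hnd₃ : 3 ≤ rkN M (((G \ coloops M G) \ {w₀, x}).filter
      (fun e => e ∈ clF M (insert c₃ R₁) ∧ e ∉ clF M R₁)))
    (hL4 : (((G \ coloops M G) \ {w₀, x}).filter (fun e => e ∈ clF M R₁)).card ≤ 4)
    {B : Finset α} (hB : B ∈ thinMembers M 5 G) (hnP : ¬ bigP M G B) {z : α} (hz : z ∈ G \ clF M B)
    (hl0 : loss M 5 G B z ≠ 0) (hw₀ : w₀ ∈ insert z B) (hx : x ∉ insert z B) (hN : (G \ insert z B).card = 7)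
    {a : α} (hP₀a : ∀ e ∈ insert z B \ coloops M G, e ∈ clF M R₁ → e = a)
    {y₂ : α} (hy₂ : y₂ ∈ (G \ insert z B).erase x) (hy₂2 : y₂ ∈ clF M (insert c₂ R₁)) (hy₂L : y₂ ∉ clF M R₁)
    (hA1 : ∀ u ∈ (G \ insert z B).erase x, u ∈ clF M (insert c₂ R₁) → u ∉ clF M R₁ → u = y₂) :
    loss M 5 G B z ≤ rhoL M 5 G B z * lossIncomeH M 5 G (bigP M G) (dshGT2 M 5 G) B z := by
  have hd' : (gr M \ G).card ≤ 5 := by omega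
  have hxG : x ∈ G \ insert z B := by
    refine Finset.mem_sdiff.2 ⟨?_, hx⟩
    have : x ∈ G \ clF M B₀ := by
      rw [hD]
      exact Finset.mem_insert_of_mem (Finset.mem_singleton_self _)
    exact (Finset.mem_sdiff.1 this).1
  have hyG : y₂ ∈ G \ insert z B := Finset.mem_of_mem_erase hy₂
  have hxy : x ≠ y₂ := fun h' => (Finset.mem_erase.1 hy₂).1 h'.symm
  have hD1y := d1_through_off_spine_of_one_basis_point hG hd hk hs hl hfat hB₀ hD hR₁V hR₁2 hR₁3 hc₂V hc₃V hc₂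
    hc₃ hcover hnd₂ hnd₃ hB hnP hz hx hP₀a hy₂ hy₂L
  have htop : ∀ T ∈ tgtSets M 5 G B z, x ∈ T → 5 ≤ (T \ insert z B).card →
      dload M 5 G (bigP M G) (dshGT2 M 5 G) T = 0 := by
    intro T hT _ h5
    have hTG : T ⊆ G := subset_G_of_mem_shadowAt (mem_tgtSets.1 hT).1
    have hGT := card_sdiff_add_card_sdiff_of_mem_tgtSets hT
    have hsub : ((T \ coloops M G) \ {w₀, x}).filter (fun e => e ∈ clF M R₁) ⊆
        ((G \ coloops M G) \ {w₀, x}).filter (fun e => e ∈ clF M R₁) :=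
      Finset.filter_subset_filter _
        (Finset.sdiff_subset_sdiff (Finset.sdiff_subset_sdiff hTG (Finset.Subset.refl _)) (Finset.Subset.refl _))
    have := Finset.card_le_card hsub
    exact dload_eq_zero_of_top_of_spine_le hG hd hk hs hl hfat hB₀ hD hR₁V hR₁2 hR₁3 hc₂V hc₃V hc₂ hc₃ hcover
      hnd₂ hnd₃ hB hnP hz hT (by omega) (by omega)
  have hg0 : ∀ T ∈ (tgtSets M 5 G B z).filter
      (fun T => x ∈ T ∧ dload M 5 G (bigP M G) (dshGT2 M 5 G) T = 0),
      0 ≤ capS M 5 G T / ((221 / 360 : ℚ) * ((2 * ((T \ coloops M G).card - 2).choose 4 : ℕ) : ℚ)) :=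
    fun T _ => div_nonneg (capS_nonneg' hG hd' T) (by positivity)
  have hl1 := fat_count_level_ge' hG hd hk hB hnP hz hxG (j := 1) (by norm_num)
    (fun T hT _ h1 => dload_eq_zero_of_card_sdiff_le_six hG hd hk hs hl
      (by rw [card_sdiff_coloops_eq_level_add_five hG hd hk hB hnP hz hT, h1]))
  have hl5 := fat_count_level_ge' hG hd hk hB hnP hz hxG (j := 5) (by norm_num)
    (fun T hT hxT h5 => htop T hT hxT (by omega))
  have hl6 := fat_count_level_ge' hG hd hk hB hnP hz hxG (j := 6) (by norm_num)
    (fun T hT hxT h6 => htop T hT hxT (by omega))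
  have hl7 := fat_count_level_ge' hG hd hk hB hnP hz hxG (j := 7) (by norm_num)
    (fun T hT hxT h7 => htop T hT hxT (by omega))
  apply basis_pair_fair_of_fat_count_sum hG hd hk hs hl hfat hB₀ hD hne hB hnP hz hl0 hw₀ hx
  by_cases hfree : ∀ p ∈ (insert z B \ coloops M G).erase w₀, ∀ q ∈ (insert z B \ coloops M G).erase w₀, p ≠ q →
      rkN M {p, q, y₂} = 3
  · -- `y₂` on no basis line: the levels `2`–`7` through `x, y₂`
    have hload : ∀ T ∈ tgtSets M 5 G B z, x ∈ T → y₂ ∈ T → dload M 5 G (bigP M G) (dshGT2 M 5 G) T = 0 :=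
      fun _ hT hxT hyT => dload_eq_zero_through_free_off_spine hG hd hk hs hl hfat hB₀ hD hR₁V hR₁2 hR₁3 hc₂V hc₃V
        hc₂ hc₃ hcover hnd₂ hnd₃ hB hnP hz hx hP₀a hy₂ hy₂L hfree hT hxT hyT
    have hsum := sum_levels_le_sum hg0 (fun T => (T \ insert z B).card) {1, 2, 3, 4, 5, 6, 7}
    rw [Finset.sum_insert (by decide), Finset.sum_insert (by decide), Finset.sum_insert (by decide),
      Finset.sum_insert (by decide), Finset.sum_insert (by decide), Finset.sum_insert (by decide),
      Finset.sum_singleton] at hsum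
    have hl2 := fat_count_level_ge_pair hG hd hk hB hnP hz hxG hyG hxy (j := 2) (by norm_num)
      (fun T hT hxT hyT _ => hload T hT hxT hyT)
    have hl3 := fat_count_level_ge_pair hG hd hk hB hnP hz hxG hyG hxy (j := 3) (by norm_num)
      (fun T hT hxT hyT _ => hload T hT hxT hyT)
    have hl4 := fat_count_level_ge_pair hG hd hk hB hnP hz hxG hyG hxy (j := 4) (by norm_num)
      (fun T hT hxT hyT _ => hload T hT hxT hyT)
    rw [hN] at hl1 hl2 hl3 hl4 hl5 hl6 hl7
    have hnum : (1 : ℚ) ≤ (((7 - 1).choose (1 - 1) : ℕ) : ℚ) * fatTerm 1 (if 7 - 1 ≤ 3 then 1 else 11 / 18) +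
        ((((7 - 2).choose (2 - 2) : ℕ) : ℚ) * fatTerm 2 (if 7 - 2 ≤ 3 then 1 else 11 / 18) +
        (((7 - 2).choose (3 - 2) : ℕ) : ℚ) * fatTerm 3 (if 7 - 3 ≤ 3 then 1 else 11 / 18) +
        (((7 - 2).choose (4 - 2) : ℕ) : ℚ) * fatTerm 4 (if 7 - 4 ≤ 3 then 1 else 11 / 18) +
        (((7 - 1).choose (5 - 1) : ℕ) : ℚ) * fatTerm 5 (if 7 - 5 ≤ 3 then 1 else 11 / 18) +
        (((7 - 1).choose (6 - 1) : ℕ) : ℚ) * fatTerm 6 (if 7 - 6 ≤ 3 then 1 else 11 / 18) +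
        (((7 - 1).choose (7 - 1) : ℕ) : ℚ) * fatTerm 7 (if 7 - 7 ≤ 3 then 1 else 11 / 18)) := by
      unfold fatTerm
      norm_num [Nat.choose]
    linarith
  · -- `y₂` on the basis line `ℓ_pq`, which carries at most one other point of `W ∖ {x}`
    obtain ⟨p, hp, q, hq, hpq, hline⟩ : ∃ p ∈ (insert z B \ coloops M G).erase w₀,
        ∃ q ∈ (insert z B \ coloops M G).erase w₀, p ≠ q ∧ rkN M {p, q, y₂} ≤ 2 := by
      by_contra hcon
      apply hfree
      intro p hp q hq hpq
      have h3 : rkN M {p, q, y₂} ≤ 3 := le_trans (rkN_le_card _) Finset.card_le_three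
      by_contra hne3
      exact hcon ⟨p, hp, q, hq, hpq, by omega⟩
    have hs1 := card_line_through_off_spine_le_one hG hd hs hR₁V hR₁2 hc₂V hc₃V hc₂ hc₃ hcover hB hz hw₀ hxG hy₂
      hy₂2 hy₂L hA1 hp hq hpq hline
    have hsum := sum_levels_le_sum hg0 (fun T => (T \ insert z B).card) {1, 3, 4, 5, 6, 7}
    rw [Finset.sum_insert (by decide), Finset.sum_insert (by decide), Finset.sum_insert (by decide),
      Finset.sum_insert (by decide), Finset.sum_insert (by decide), Finset.sum_singleton] at hsum
    have hl3 := fat_count_level_ge_line_point_of_D1y' hG hd hk hs hl hD hB hnP hz hD1y hxG hy₂ hp hq hpq hline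
      (j := 3) (by norm_num)
    have hl4 := fat_count_level_ge_line_point_of_D1y' hG hd hk hs hl hD hB hnP hz hD1y hxG hy₂ hp hq hpq hline
      (j := 4) (by norm_num)
    rw [hN] at hl1 hl3 hl4 hl5 hl6 hl7
    have hnum := fat_count_numeric_line_point_seven
      ((((G \ insert z B).erase x).filter (fun y => rkN M (insert y {p, q}) ≤ 2)).erase y₂).card (by omega)
    linarith

/-- **One basis point on the spine, `N ≥ 8`, a unique point `y₂` of `W ∖ {x}` in `π₂` off the spine**: the free-point
theorem when `y₂` is on no basis line, the line-point count (`s ≤ 1`) when it is. -/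
theorem basis_pair_fair_fat_of_two_planes_one_eight_le (hG : G ∈ flatsQ M (5 + 1)) (hd : (gr M \ G).card = 2)
    (hk : kColoops M G = 1) (hs : ∀ e ∈ gr M, ∀ f ∈ gr M, e ≠ f → rkN M {e, f} = 2)
    (hl : ∀ e ∈ gr M, M.Indep {e}) (hfat : (fatClosures M 5 G 2).card ≤ 1)
    {B₀ : Finset α} (hB₀ : B₀ ∈ thinMembers M 5 G) {w₀ x : α} (hD : G \ clF M B₀ = {w₀, x}) (hne : w₀ ≠ x) {R₁ : Finset α}
    (hR₁V : R₁ ⊆ (G \ coloops M G) \ {w₀, x}) (hR₁2 : rkN M R₁ = 2) (hR₁3 : 3 ≤ R₁.card) {c₂ c₃ : α}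
    (hc₂V : c₂ ∈ (G \ coloops M G) \ {w₀, x}) (hc₃V : c₃ ∈ (G \ coloops M G) \ {w₀, x})
    (hc₂ : c₂ ∉ clF M R₁) (hc₃ : c₃ ∉ clF M (insert c₂ R₁))
    (hcover : ∀ e ∈ (G \ coloops M G) \ {w₀, x}, e ∈ clF M (insert c₂ R₁) ∨ e ∈ clF M (insert c₃ R₁))
    (hnd₂ : 3 ≤ rkN M (((G \ coloops M G) \ {w₀, x}).filter
      (fun e => e ∈ clF M (insert c₂ R₁) ∧ e ∉ clF M R₁)))
    (hnd₃ : 3 ≤ rkN M (((G \ coloops M G) \ {w₀, x}).filter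
      (fun e => e ∈ clF M (insert c₃ R₁) ∧ e ∉ clF M R₁)))
    {B : Finset α} (hB : B ∈ thinMembers M 5 G) (hnP : ¬ bigP M G B) {z : α} (hz : z ∈ G \ clF M B)
    (hl0 : loss M 5 G B z ≠ 0) (hw₀ : w₀ ∈ insert z B) (hx : x ∉ insert z B) (hN : 8 ≤ (G \ insert z B).card)
    {a : α} (hP₀a : ∀ e ∈ insert z B \ coloops M G, e ∈ clF M R₁ → e = a)
    {y₂ : α} (hy₂ : y₂ ∈ (G \ insert z B).erase x) (hy₂2 : y₂ ∈ clF M (insert c₂ R₁)) (hy₂L : y₂ ∉ clF M R₁)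
    (hA1 : ∀ u ∈ (G \ insert z B).erase x, u ∈ clF M (insert c₂ R₁) → u ∉ clF M R₁ → u = y₂) :
    loss M 5 G B z ≤ rhoL M 5 G B z * lossIncomeH M 5 G (bigP M G) (dshGT2 M 5 G) B z := by
  have hd' : (gr M \ G).card ≤ 5 := by omega
  have hxG : x ∈ G \ insert z B := by
    refine Finset.mem_sdiff.2 ⟨?_, hx⟩
    have : x ∈ G \ clF M B₀ := by
      rw [hD]
      exact Finset.mem_insert_of_mem (Finset.mem_singleton_self _)
    exact (Finset.mem_sdiff.1 this).1
  have hyG : y₂ ∈ G \ insert z B := Finset.mem_of_mem_erase hy₂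
  have hxy : x ≠ y₂ := fun h' => (Finset.mem_erase.1 hy₂).1 h'.symm
  by_cases hfree : ∀ p ∈ (insert z B \ coloops M G).erase w₀, ∀ q ∈ (insert z B \ coloops M G).erase w₀, p ≠ q →
      rkN M {p, q, y₂} = 3
  · exact basis_pair_fair_fat_of_free_point hG hd hk hs hl hfat hB₀ hD hne hB hnP hz hl0 hw₀ hx hyG hxy hN
      (fun _ hT hxT hyT => dload_eq_zero_through_free_off_spine hG hd hk hs hl hfat hB₀ hD hR₁V hR₁2 hR₁3 hc₂V
        hc₃V hc₂ hc₃ hcover hnd₂ hnd₃ hB hnP hz hx hP₀a hy₂ hy₂L hfree hT hxT hyT)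
  · obtain ⟨p, hp, q, hq, hpq, hline⟩ : ∃ p ∈ (insert z B \ coloops M G).erase w₀,
        ∃ q ∈ (insert z B \ coloops M G).erase w₀, p ≠ q ∧ rkN M {p, q, y₂} ≤ 2 := by
      by_contra hcon
      apply hfree
      intro p hp q hq hpq
      have h3 : rkN M {p, q, y₂} ≤ 3 := le_trans (rkN_le_card _) Finset.card_le_three
      by_contra hne3
      exact hcon ⟨p, hp, q, hq, hpq, by omega⟩
    have hs1 := card_line_through_off_spine_le_one hG hd hs hR₁V hR₁2 hc₂V hc₃V hc₂ hc₃ hcover hB hz hw₀ hxG hy₂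
      hy₂2 hy₂L hA1 hp hq hpq hline
    have hD1y := d1_through_off_spine_of_one_basis_point hG hd hk hs hl hfat hB₀ hD hR₁V hR₁2 hR₁3 hc₂V hc₃V hc₂
      hc₃ hcover hnd₂ hnd₃ hB hnP hz hx hP₀a hy₂ hy₂L
    apply basis_pair_fair_of_fat_count_sum hG hd hk hs hl hfat hB₀ hD hne hB hnP hz hl0 hw₀ hx
    have hg0 : ∀ T ∈ (tgtSets M 5 G B z).filter
        (fun T => x ∈ T ∧ dload M 5 G (bigP M G) (dshGT2 M 5 G) T = 0),
        0 ≤ capS M 5 G T / ((221 / 360 : ℚ) * ((2 * ((T \ coloops M G).card - 2).choose 4 : ℕ) : ℚ)) :=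
      fun T _ => div_nonneg (capS_nonneg' hG hd' T) (by positivity)
    have hsum := sum_levels_le_sum hg0 (fun T => (T \ insert z B).card) {1, 3, 4, 5, 6, 7}
    rw [Finset.sum_insert (by decide), Finset.sum_insert (by decide), Finset.sum_insert (by decide),
      Finset.sum_insert (by decide), Finset.sum_insert (by decide), Finset.sum_singleton] at hsum
    have hl1 := fat_count_level_ge' hG hd hk hB hnP hz hxG (j := 1) (by norm_num)
      (fun T hT _ h1 => dload_eq_zero_of_card_sdiff_le_six hG hd hk hs hl
        (by rw [card_sdiff_coloops_eq_level_add_five hG hd hk hB hnP hz hT, h1]))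
    have hl3 := fat_count_level_ge_line_point_of_D1y hG hd hk hs hl hD hB hnP hz hD1y hxG hy₂ hp hq hpq hline
      (j := 3) (by norm_num)
    have hl4 := fat_count_level_ge_line_point_of_D1y hG hd hk hs hl hD hB hnP hz hD1y hxG hy₂ hp hq hpq hline
      (j := 4) (by norm_num)
    have hl5 := fat_count_level_ge_line_point_of_D1y hG hd hk hs hl hD hB hnP hz hD1y hxG hy₂ hp hq hpq hline
      (j := 5) (by norm_num)
    have hl6 := fat_count_level_ge_line_point_of_D1y hG hd hk hs hl hD hB hnP hz hD1y hxG hy₂ hp hq hpq hline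
      (j := 6) (by norm_num)
    have hl7 := fat_count_level_ge_line_point_of_D1y hG hd hk hs hl hD hB hnP hz hD1y hxG hy₂ hp hq hpq hline
      (j := 7) (by norm_num)
    have hnum := fat_count_numeric_line_point ((G \ insert z B).card - 2)
      ((((G \ insert z B).erase x).filter (fun y => rkN M (insert y {p, q}) ≤ 2)).erase y₂).card (by omega) (by omega)
    have hc1 : (if (G \ insert z B).card - 1 ≤ 3 then (1 : ℚ) else 11 / 18) = 11 / 18 := by
      rw [if_neg (by omega)]
    rw [hc1] at hl1
    simp only [Nat.sub_self, Nat.choose_zero_right, Nat.cast_one, one_mul] at hl1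
    linarith

end PercRepro.Shadow
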